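import Summits.QuantumFields.YangMills.Theorems.UnitScaleTiltProp8FlatOpsLettersAssembly
import Summits.QuantumFields.YangMills.Theorems.UnitScaleTiltProp8FlatCubeOpsTextWhole
import Summits.QuantumFields.YangMills.Theorems.UnitScaleTiltProp8FlatMinimizerHLinear
import HarnessLib

/-!
# Route `UnitScaleTilt`, crux K1 child «MinimiserStabilityRegPr» (stmt-QuantumFields-19200), v8 pillar **P2 `stub_flatOpsCubeSeq`** — OWNER RULING g21-№4 §B3(a)
# «first target = the one-level instance `Domains.whole (K−n)` from p1 g14's menu (bridge `twoScale j hj ∅` ↔ `whole j`)»: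
# **THE OPERATORS OF [Balaban1984PropagatorsII] SECT. A DEPEND ON THE NESTED FAMILY ONLY THROUGH ITS TERRITORIES `Λ_j`** — two families `D₁, D₂ : Domains P` with the
# same `Λ_j` (sites and bonds) have the same `N(Q′)`, `ΔN(Q′)`, `R`, `Q*aQ`, `Δ_a` and `G = Δ_a⁻¹`; hence r03's `twoScale j hj ∅` (k = j + 1, empty top) and p21's
# `Domains.whole j` (k = j) carry THE SAME PROPAGATOR, and the `G`-ROWS OF `FlatOpsLettersAssembly.RowsAt` AT THE ONE-LEVEL FAMILY ARE A THEOREM (p1 g14/g15's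
# `FlatMinimizerHLinear.exists_flatG_linear_T3`, [Balaban1984PropagatorsI] (1.115))

Cell `ym3-torus` (HUMAN RULING D-0037, YM ladder rung R3), seat `ym3-torus-p1` gen 16.  `--supports stmt-QuantumFields-19200 --as helper`; count-neutral; def-free.

THE PRINT.  [Balaban1984PropagatorsII] p. 224: *«we admit the case when some domains Ω_j are equal to T_η, for example Ω_j = T_η for j = 1, 2, …, l»*; (2.3)–(2.4):
*«Λ_j = Ω_j^{(j)} ∖ Ω_{j+1}^{(j)} … T = ⋃_j Bʲ(Λ_j)»*; (2.7) `N(Q′)`, (2.10)–(2.12) `R` = the projection onto `ΔN(Q′)`, (2.14)/(2.19)–(2.20) `Q*aQ`, `Δ_a = ∂*∂ + ∂R∂* + Q*aQ`,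
(2.22) `G = Δ_a⁻¹` — every one of these is a functional of the index family `𝔅 = ⋃_j Λ_j` and the weights.  A family whose top domain is empty (`Ω_k = ∅`) has the
territories of the family truncated at `k − 1`.

WHAT IS PROVED (sorry-free; axioms standard; no definition).  For `D₁ D₂ : B6SectADomainsV1.Domains P` with `∀ j b, D₁.LamBond j b ↔ D₂.LamBond j b` and
`∀ j y, D₁.LamSite j y ↔ D₂.LamSite j y`:
* §1 `sum_bondIdx_eq` — a sum over the index bonds `𝔅` of `D` is the `j`-iterated sum of the `Λ_j`-indicator (reindexing, `D`-independent range);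
* §2 **`ker_QpE_eq`**, **`KE_eq`** (`N(Q′)`, `ΔN(Q′)` agree), **`RE_apply_eq`** (`R` agrees — uniqueness of the orthogonal projection), **`QsaQ_apply_eq`** (`Q*aQ` agrees
  for a constant weight `a`), **`deltaAE_apply_eq`**, **`GE_apply_eq`** (`Δ_a`, `G` agree);
* §3 the instance: `lamBond_whole_iff`/`lamSite_whole_iff` (`Λ_i` of `whole j` is everything at `i = j`, nothing else), `lamBond_twoScale_empty_iff`/`lamSite_twoScale_empty_iff`
  (the same for `twoScale j hj ∅`), **`GE_whole_eq_GE_twoScale_empty`**;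
* §4 **`gRows_whole`** — THE `G`-CONJUNCT OF `RowsAt` AT `Domains.whole (K − n)`: for every odd `L > 1` a constant `C > 0` with, for every member `F.L = L`, heights `n < K`
  and P2 weights `w` (identically `1` there), a plain-function `G` pinned (`IsFlatGW`) to the genuine `GE (whole (K−n))` at the weight `(L^{K−n})³` with
  `GtSupLetterG F n K w G C` and `GtLaplaceLetterG F n K w G C` — p1 g14's (1.115) letters carried over by §3.
HONEST SCOPE.  Finite-dimensional bookkeeping; the `H`-kernel rows and the (162) row sum at the one-level family are not in this file; NOT a claim about the mass gap.

References: T. Bałaban, CMP **96** (1984) 223–250 [Balaban1984PropagatorsII] (2.1)–(2.4) p.224, (2.7)–(2.12) p.224–225, (2.14) p.225, (2.19)–(2.22) p.226; CMP **95** (1984)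
17–40 [Balaban1984PropagatorsI] (1.115) p.36.
-/

set_option autoImplicit false

noncomputable section

open scoped BigOperators InnerProductSpace

namespace Summit.QuantumFields.YangMills.Theorems.FlatDomainsCongr

open Literature.MathematicalPhysics.QuantumFieldTheory.Balaban1983to89
open Literature.MathematicalPhysics.QuantumFieldTheory.BalabanImbrieJaffe1984to88.BIJ85AxialPropagator411 (BondSpace)
open LatticeFieldCalculus (bondAvgIter)
open B6SectADomainsV1 (Domains)
open B6SectAOperatorsV1 (BondIdx BondIdxSpace ScalarSpace QE QpE QsE aE dE dsE dcE dcsE KE RE lapE QE_apply aE_apply inner_QsE_left inner_eq_sum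
  mem_ker_QpE_iff RE_apply RE_mem)
open B6SectAVectorModelV1 (deltaAE GE deltaAE_def GE_deltaAE deltaAE_GE)
open B6SectCTwoScaleV1 (twoScale)
open T3ContinuumYM3Torus (T3Family)
open FlatCubeOpsText (IsLevWeight GtSupLetterG GtLaplaceLetterG)
open FlatOpsLettersAssembly (IsFlatGW)
open Prop7FlatCoercivityR (succ_le_T3)
open FlatMinimizerH (le_T3)

variable {P : Params}

/-! ## §1 Reindexing sums over the index bonds -/

/-- a sum over `𝔅 = ⋃_{j ≤ k} Λ_j` (bonds) is the iterated sum of the `Λ_j`-indicators over a `D`-independent range of levels. [cite: Balaban1984PropagatorsII, (2.3)-(2.4) p.224] -/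
theorem sum_bondIdx_eq (D : Domains P) (g : (j : ℕ) → PBond P j → ℝ) :
    ∑ i : BondIdx D, g i.1.1 i.1.2 = ∑ j ∈ Finset.range (P.m + P.K + 1), ∑ b : PBond P j, if D.LamBond j b then g j b else 0 := by
  classical
  have h1 : ∑ i : BondIdx D, g i.1.1 i.1.2 =
      ∑ p ∈ (Finset.univ.filter fun p : (j : Fin (D.k + 1)) × PBond P (j : ℕ) => D.LamBond p.1 p.2), g p.1 p.2 :=
    (Finset.sum_subtype (Finset.univ.filter fun p : (j : Fin (D.k + 1)) × PBond P (j : ℕ) => D.LamBond p.1 p.2) (by simp)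
      (fun p : (j : Fin (D.k + 1)) × PBond P (j : ℕ) => g p.1 p.2)).symm
  rw [h1, Finset.sum_filter, Fintype.sum_sigma,
    Fin.sum_univ_eq_sum_range (fun j => ∑ b : PBond P j, if D.LamBond j b then g j b else 0) (D.k + 1)]
  refine Finset.sum_subset (Finset.range_subset_range.2 (by have := D.hk; omega)) fun j _ hj => ?_
  have hjk : D.k < j := by
    rw [Finset.mem_range] at hj
    omega
  exact Finset.sum_eq_zero fun b _ => if_neg (D.not_lamBond_of_lt hjk b)

/-! ## §2 Families with the same territories have the same Sect. A operators -/

section Congr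

variable {D₁ D₂ : Domains P} (hB : ∀ (j : ℕ) (b : PBond P j), D₁.LamBond j b ↔ D₂.LamBond j b)
  (hS : ∀ (j : ℕ) (y : Site P j), D₁.LamSite j y ↔ D₂.LamSite j y)

include hS in
/-- **`N(Q′)` AGREES**: the gauge functions annihilated by `Q′` on `Λ_j`, `j = 0, …` are the same. [cite: Balaban1984PropagatorsII, (2.7) p.224, (2.10) p.225] -/
theorem ker_QpE_eq : LinearMap.ker (QpE D₁) = LinearMap.ker (QpE D₂) := by
  ext f
  rw [mem_ker_QpE_iff, mem_ker_QpE_iff]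
  exact ⟨fun h j y hy => h j y ((hS j y).2 hy), fun h j y hy => h j y ((hS j y).1 hy)⟩

include hS in
/-- **`ΔN(Q′)` AGREES**. [cite: Balaban1984PropagatorsII, (2.10) p.225] -/
theorem KE_eq (c : ℝ) : KE D₁ c = KE D₂ c := by
  unfold KE
  rw [ker_QpE_eq hS]

include hS in
/-- **`R` AGREES** (the orthogonal projection onto the common `ΔN(Q′)`; uniqueness of the projection). [cite: Balaban1984PropagatorsII, (2.12) p.225] -/
theorem RE_apply_eq (c : ℝ) (f : ScalarSpace P) : RE D₁ c f = RE D₂ c f := by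
  have hK := KE_eq hS c
  rw [RE_apply D₂]
  symm
  refine Submodule.eq_starProjection_of_mem_orthogonal ?_ ?_
  · rw [← hK]; exact RE_mem D₁ c f
  · rw [← hK, RE_apply]
    exact Submodule.sub_starProjection_mem_orthogonal f

include hB in
/-- **`Q*aQ` AGREES for a constant weight `a`** (both are `Σ_j Σ_{b∈Λ_j} a·(Q_j·)(b)(Q_j·)(b)`). [cite: Balaban1984PropagatorsII, (2.14) p.225, (2.20) p.226] -/
theorem QsaQ_apply_eq (a : ℝ) (x : BondSpace P) :
    QsE D₁ (aE D₁ (fun _ => a) (QE D₁ x)) = QsE D₂ (aE D₂ (fun _ => a) (QE D₂ x)) := by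
  refine ext_inner_right ℝ fun y => ?_
  rw [inner_QsE_left, inner_QsE_left, inner_eq_sum, inner_eq_sum]
  simp only [aE_apply, QE_apply]
  rw [sum_bondIdx_eq D₁ (fun j b => a * bondAvgIter j (WithLp.ofLp x) b * bondAvgIter j (WithLp.ofLp y) b),
    sum_bondIdx_eq D₂ (fun j b => a * bondAvgIter j (WithLp.ofLp x) b * bondAvgIter j (WithLp.ofLp y) b)]
  refine Finset.sum_congr rfl fun j _ => Finset.sum_congr rfl fun b _ => ?_
  simp only [hB j b]

include hB hS in
/-- **`Δ_a` AGREES** for a constant weight. [cite: Balaban1984PropagatorsII, (2.19) p.226] -/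
theorem deltaAE_apply_eq (c a : ℝ) (x : BondSpace P) : deltaAE D₁ c (fun _ => a) x = deltaAE D₂ c (fun _ => a) x := by
  simp only [deltaAE_def, LinearMap.add_apply, LinearMap.comp_apply]
  rw [RE_apply_eq hS, QsaQ_apply_eq hB]

include hB hS in
/-- **`G = Δ_a⁻¹` AGREES** for a constant positive weight. [cite: Balaban1984PropagatorsII, (2.22) p.226] -/
theorem GE_apply_eq {c : ℝ} (hc : c ≠ 0) {a : ℝ} (ha : 0 < a) (x : BondSpace P) :
    GE D₁ hc (w := fun _ => a) (fun _ => ha) x = GE D₂ hc (w := fun _ => a) (fun _ => ha) x := by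
  have h : x = deltaAE D₂ c (fun _ => a) (GE D₁ hc (w := fun _ => a) (fun _ => ha) x) := by
    rw [← deltaAE_apply_eq hB hS, deltaAE_GE]
  conv_rhs => rw [h, GE_deltaAE]

end Congr

/-! ## §3 The instance: `whole j` and `twoScale j hj ∅` have the same territories -/

section Instance

variable {j : ℕ}

/-- the all-torus family `whole j`: `Λ_i` (bonds) is everything at `i = j` and empty otherwise. [cite: Balaban1984PropagatorsII, (2.1)-(2.4) p.224] -/
theorem lamBond_whole_iff (hk : j ≤ P.m + P.K) (i : ℕ) (b : PBond P i) : (Domains.whole j hk : Domains P).LamBond i b ↔ i = j := by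
  rcases lt_trichotomy i j with hij | rfl | hij
  · have h1 : (Domains.whole j hk : Domains P).Om (i + 1) = Finset.univ := FlatCubeOpsTextWhole.whole_Om_of_le hk (by omega)
    simp [Domains.LamBond, Domains.Deep, h1, hij.ne]
  · have h0 : (Domains.whole i hk : Domains P).Om i = Finset.univ := FlatCubeOpsTextWhole.whole_Om_of_le hk le_rfl
    have h1 : (Domains.whole i hk : Domains P).Om (i + 1) = ∅ := FlatCubeOpsTextWhole.whole_Om_of_lt hk (by omega)
    simp [Domains.LamBond, Domains.Deep, h0, h1]
  · have h0 : (Domains.whole j hk : Domains P).Om i = ∅ := FlatCubeOpsTextWhole.whole_Om_of_lt hk hij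
    simp [Domains.LamBond, h0, hij.ne']

/-- the all-torus family `whole j`: `Λ_i` (sites) is everything at `i = j` and empty otherwise. [cite: Balaban1984PropagatorsII, (2.1)-(2.4) p.224] -/
theorem lamSite_whole_iff (hk : j ≤ P.m + P.K) (i : ℕ) (y : Site P i) : (Domains.whole j hk : Domains P).LamSite i y ↔ i = j := by
  rcases lt_trichotomy i j with hij | rfl | hij
  · have h1 : (Domains.whole j hk : Domains P).Om (i + 1) = Finset.univ := FlatCubeOpsTextWhole.whole_Om_of_le hk (by omega)
    simp [Domains.LamSite, Domains.Deep, h1, hij.ne]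
  · have h0 : (Domains.whole i hk : Domains P).Om i = Finset.univ := FlatCubeOpsTextWhole.whole_Om_of_le hk le_rfl
    have h1 : (Domains.whole i hk : Domains P).Om (i + 1) = ∅ := FlatCubeOpsTextWhole.whole_Om_of_lt hk (by omega)
    simp [Domains.LamSite, Domains.Deep, h0, h1]
  · have h0 : (Domains.whole j hk : Domains P).Om i = ∅ := FlatCubeOpsTextWhole.whole_Om_of_lt hk hij
    simp [Domains.LamSite, h0, hij.ne']

/-- r03's two-scale family with EMPTY top `twoScale j hj ∅` (`k = j + 1`): `Λ_i` (bonds) is everything at `i = j`, empty otherwise. [cite: Balaban1984PropagatorsII, (2.89) p.239, (2.97) p.240] -/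
theorem lamBond_twoScale_empty_iff (hj : j + 1 ≤ P.m + P.K) (i : ℕ) (b : PBond P i) :
    (twoScale j hj (∅ : Finset (Site P (j + 1)))).LamBond i b ↔ i = j := by
  rcases lt_trichotomy i j with hij | rfl | hij
  · simp [B6SectCTwoScaleV1.twoScale.not_lamBond_of_lt hij b, hij.ne]
  · simp [B6SectCTwoScaleV1.twoScale.lamBond_j]
  · rcases Nat.lt_or_ge (j + 1) i with h | h
    · simp [B6SectCTwoScaleV1.twoScale.not_lamBond_of_gt h b, hij.ne']
    · obtain rfl : i = j + 1 := le_antisymm h hij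
      simp [B6SectCTwoScaleV1.twoScale.lamBond_succ]

/-- `twoScale j hj ∅`: `Λ_i` (sites) is everything at `i = j`, empty otherwise. [cite: Balaban1984PropagatorsII, (2.89) p.239, (2.97) p.240] -/
theorem lamSite_twoScale_empty_iff (hj : j + 1 ≤ P.m + P.K) (i : ℕ) (y : Site P i) :
    (twoScale j hj (∅ : Finset (Site P (j + 1)))).LamSite i y ↔ i = j := by
  rcases lt_trichotomy i j with hij | rfl | hij
  · simp [B6SectCTwoScaleV1.twoScale.not_lamSite_of_lt hij y, hij.ne]
  · simp [B6SectCTwoScaleV1.twoScale.lamSite_j]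
  · rcases Nat.lt_or_ge (j + 1) i with h | h
    · simp [B6SectCTwoScaleV1.twoScale.not_lamSite_of_gt h y, hij.ne']
    · obtain rfl : i = j + 1 := le_antisymm h hij
      simp [B6SectCTwoScaleV1.twoScale.lamSite_succ]

/-- **THE ONE-LEVEL PROPAGATOR IS THE SAME FOR `whole j` AND `twoScale j hj ∅`** (constant positive weight, any lattice factor). [cite: Balaban1984PropagatorsII, (2.1) p.224, (2.22) p.226] -/
theorem GE_whole_eq_GE_twoScale_empty (hk : j ≤ P.m + P.K) (hj : j + 1 ≤ P.m + P.K) {c : ℝ} (hc : c ≠ 0) {a : ℝ} (ha : 0 < a) (x : BondSpace P) :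
    GE (Domains.whole j hk) hc (w := fun _ => a) (fun _ => ha) x = GE (twoScale j hj (∅ : Finset (Site P (j + 1)))) hc (w := fun _ => a) (fun _ => ha) x :=
  GE_apply_eq (fun i b => (lamBond_whole_iff hk i b).trans (lamBond_twoScale_empty_iff hj i b).symm)
    (fun i y => (lamSite_whole_iff hk i y).trans (lamSite_twoScale_empty_iff hj i y).symm) hc ha x

end Instance

/-! ## §4 The `G`-rows of `RowsAt` at the one-level family `Domains.whole (K − n)` -/

section Whole

/-- **THE `G`-CONJUNCT OF `FlatOpsLettersAssembly.RowsAt` AT THE ONE-LEVEL FAMILY IS A THEOREM**: for odd `L > 1` a constant `C > 0` such that for every member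
`F.L = L`, heights `n < K` and P2 weights `w` (identically `1` at `whole (K−n)`), there is a plain-function `G`, pinned by `IsFlatGW` to the genuine
`GE (whole (K−n))` at the weight `(L^{K−n})³`, with the `(−3) → (−1), (−2)` rows `GtSupLetterG F n K w G C` and the Laplacian row `GtLaplaceLetterG F n K w G C` —
[Balaban1984PropagatorsI] (1.115) through p1 g14/g15's `FlatMinimizerHLinear.exists_flatG_linear_T3` and §3. [cite: Balaban1984PropagatorsI, (1.115) p.36; Balaban1984PropagatorsII, (2.1) p.224, (2.22) p.226] -/
theorem gRows_whole (L : ℕ) (hL : Odd L ∧ 1 < L) :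
    ∃ C : ℝ, 0 < C ∧ ∀ (F : T3Family), F.L = L → ∀ (n K : ℕ), n < K →
      ∀ (w : ℕ → PBond (F.P K) 0 → ℝ), IsLevWeight F n K (Domains.whole (K - n) (le_T3 F n K)) w →
      ∃ (w' : BondIdx (Domains.whole (K - n) (le_T3 F n K)) → ℝ) (hw' : ∀ i, 0 < w' i)
        (G : (PBond (F.P K) 0 → ℝ) →ₗ[ℝ] (PBond (F.P K) 0 → ℝ)),
        IsFlatGW F n K (Domains.whole (K - n) (le_T3 F n K)) hw' G ∧ GtSupLetterG F n K w G C ∧ GtLaplaceLetterG F n K w G C := by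
  obtain ⟨C, hC, h⟩ := FlatMinimizerHLinear.exists_flatG_linear_T3 L hL one_pos
  refine ⟨C, hC, fun F hF n K hnK w hw => ?_⟩
  obtain ⟨G, hGpin, hG0, hG1, hG2⟩ := h F hF n K hnK
  have ha : (0 : ℝ) < 1 * ((F.L : ℝ) ^ (K - n)) ^ 3 := by
    have : (0 : ℝ) < (F.L : ℝ) := by exact_mod_cast lt_trans zero_lt_one F.hL.2
    positivity
  have hw1 : ∀ m b, w m b = 1 := FlatCubeOpsTextWhole.levWeight_whole_eq_one F n K (le_T3 F n K) w hw
  refine ⟨fun _ => 1 * ((F.L : ℝ) ^ (K - n)) ^ 3, fun _ => ha, G, ?_, ?_, ?_⟩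
  · intro f b
    rw [hGpin f b, GE_whole_eq_GE_twoScale_empty (le_T3 F n K) (succ_le_T3 F n K)]
  · intro f β _ hf
    have hf' : ∀ b', |f b'| ≤ β := fun b' => by simpa [hw1 3 b'] using hf b'
    refine ⟨fun b => ?_, fun b ν => ?_⟩
    · rw [hw1 1 b, one_mul]
      exact hG0 f β hf' b
    · rw [hw1 2 b, one_mul]
      exact hG1 f β hf' b.src b.dir ν
  · intro f β _ hf b
    have hf' : ∀ b', |f b'| ≤ β := fun b' => by simpa [hw1 3 b'] using hf b'
    rw [hw1 3 b, one_mul]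
    exact hG2 f β hf' b.src b.dir

end Whole

end Summit.QuantumFields.YangMills.Theorems.FlatDomainsCongr

end
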